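import HarnessLib
import Summits.QuantumFields.YangMills.Theorems.BalabanLadderUVSeamRecStubTransport
import Summits.QuantumFields.YangMills.Theorems.BalabanLadderUVSeamRecClassicalResponseGauge
import Summits.QuantumFields.YangMills.Theorems.BalabanLadderNTClassicalShadowOrbitGauge

/-! Rung for (CWX) of LINE «extremal-coldwall» (crux UVSeamRec, 20043), ideator ym-idea-10 g2: the cold-wall extremality inequality holds WITH EQUALITY for every
PURE-GAUGE exterior `g·𝟙` (gauge covariance of the cube kernel + gauge invariance of the plaquette field) — the `η` for which the classical response vanishes
identically are exactly accounted for; no content about fluxed exteriors is claimed. -/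

namespace Summit.QuantumFields.YangMills.Cruxes.UVSeamRec.ExtremalColdWall

open MeasureTheory Filter Topology
open Literature.MathematicalPhysics.QuantumFieldTheory Literature.MathematicalPhysics.QuantumLattice
open Literature.Probability.LatticeModels
open Summit.QuantumFields.YangMills.Cruxes.OSLegsFromFemtoAndGap.DlrCollarTransfer
open Summit.QuantumFields.YangMills.Cruxes.NT.ClassicalShadow (kerE_gaugeTransformZd)
open Summit.QuantumFields.YangMills.Cruxes.UVSeamRec.ClassicalResponse (plane_gaugeTransformZd)

/-- (CWX) with equality on the gauge orbit of the cold wall, for every compact group and representation. -/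
theorem kerE_plane_pureGauge_eq {G : Type} [Group G] [TopologicalSpace G] [IsTopologicalGroup G] [CompactSpace G]
    [MeasurableSpace G] [BorelSpace G] (r : LatticeRep G) (β : ℝ) (c : Fin 4 → ℤ) (b : ℕ) (g : (Fin 4 → ℤ) → G)
    (q : Fin 4 × Fin 4) (x : Fin 4 → ℤ) :
    kerE G r β c b (gaugeTransformZd g 1) (plane G r q x) = kerE G r β c b 1 (plane G r q x) := by
  haveI : SecondCountableTopology G := (Continuous.isClosedEmbedding r.continuous r.injective).isEmbedding.secondCountableTopology
  rw [kerE_gaugeTransformZd r β c b 1 g (continuous_plane r q x).measurable]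
  congr 1
  funext U
  exact plane_gaugeTransformZd r q x g U

/-- The (CWX) inequality on the gauge orbit of the cold wall (SU(2), fundamental), unconditionally in `β`, `R`. -/
theorem coldWallExtremal_pureGauge (β : ℝ) (R : ℕ) (q : Fin 4 × Fin 4) (x : Fin 4 → ℤ)
    (g : (Fin 4 → ℤ) → Matrix.specialUnitaryGroup (Fin 2) ℂ) :
    kerE (Matrix.specialUnitaryGroup (Fin 2) ℂ) (fundamentalLatticeRep 2) β (fun k => x k - (R + 1)) (2 * R + 3) (gaugeTransformZd g 1)
        (plane (Matrix.specialUnitaryGroup (Fin 2) ℂ) (fundamentalLatticeRep 2) q x) ≤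
      kerE (Matrix.specialUnitaryGroup (Fin 2) ℂ) (fundamentalLatticeRep 2) β (fun k => x k - (R + 1)) (2 * R + 3) 1
        (plane (Matrix.specialUnitaryGroup (Fin 2) ℂ) (fundamentalLatticeRep 2) q x) :=
  (kerE_plane_pureGauge_eq (fundamentalLatticeRep 2) β _ _ g q x).le

end Summit.QuantumFields.YangMills.Cruxes.UVSeamRec.ExtremalColdWall
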